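import Literature.Computability.Cryptography.LWECandidateSelect
import Literature.Computability.Cryptography.LWESwitchMachineKernel
import Literature.Computability.Cryptography.LWERateGuessPerturb
import Literature.Probability.Distributions.IndepProductLawDistance
import HarnessLib

/-!
# Selecting among candidate distinguishers with an APPROXIMATE self-measurement

Topic `Computability/Cryptography` (LWE), grouping namespace `LWE`; sequel of `LWECandidateSelect.lean` (`selectDistinguisher χ E N`: measure every
candidate on `N` self-generated `LWE_{χ}` tuples and `N` uniform tuples — the law `candEstLaw χ E N` — then run the empirically best one, flipped
if its gap is negative; `distinguishingAdvantage_selectDistinguisher_ge`). A MACHINE cannot draw the self-generated `LWE_{χ}` tuples exactly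
when `χ` is a discretized Gaussian (irrational weights): it draws them from laws `ν`-close in statistical distance. This file proves that the
selection is ROBUST to that (everything PROVED; two definitions with bodies; no named fact):

* `candEstLawWith E N P_lwe P_unif` (the measurement law for arbitrary self-test laws; `= candEstLaw` at the genuine ones), `selectWith E N Est`
  (select using an arbitrary measurement law `Est`; `= selectDistinguisher` at `candEstLaw`), `pacc_selectWith`, `sAdv_selectWith`;
* `abs_sAdv_selectWith_sub_le` — `|sAdv (selectWith Est) − sAdv (selectWith Est')| ≤ 2·Δ(Est, Est')`;
* `sAdv_selectDistinguisher_ge` (the SIGNED form of the selection guarantee), **`distinguishingAdvantage_selectWith_ge`** — if some candidate has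
  advantage `≥ η` and `Δ(Est, candEstLaw χ E N) ≤ δ`, then `Adv[selectWith Est] ≥ η/2 − 2(k+1)·32/(Nη²) − 2δ`;
* **`tvDist_candEstLawWith_le`** — `Δ(candEstLawWith P P', candEstLawWith P₀ P₀') ≤ (k+1)·N·(Δ(P, P₀) + Δ(P', P₀'))` (independent coordinates,
  `N` iid verdicts per coordinate, data processing through the candidate).

## References

* Z. Brakerski, A. Langlois, C. Peikert, O. Regev, D. Stehlé, *Classical hardness of learning with errors*, STOC 2013; arXiv:1306.0281,
  Thm. 4.1 (proof: selecting among the three reductions) and §5. [BrakerskiEtAl2013]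
* O. Regev, *On lattices, learning with errors …*, J. ACM 56 (2009), Lemma 4.1 (proof: estimating with self-generated samples). [RegevLWE2009]
* O. Goldreich, *Foundations of Cryptography I*, CUP 2001, §3.2.1–§3.2.3 (statistical distance under processing and independent samples). [Goldreich2001]
-/

noncomputable section

open scoped ENNReal
open PMF Literature.Probability.Distributions Literature.Computability.Cryptography.BLPRS2013

namespace Literature.Computability.Cryptography

namespace LWE

open MP12

variable {ι : Type} [Fintype ι] [DecidableEq ι] {R : Type} [CommRing R] [Fintype R]
variable (χ : PMF R) {m : ℕ} {k : ℕ} (E : Fin (k + 1) → Distinguisher ι R m) (N : ℕ)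

/-! ### The measurement with arbitrary self-test laws, and the selection with an arbitrary measurement law -/

/-- **The measurement law for arbitrary self-test laws** `P_lwe`, `P_unif`. [cite: RegevLWE2009, Lemma 4.1 (proof)] -/
def candEstLawWith (Plwe Punif : PMF (Fin m → (ι → R) × R)) : PMF (Fin (k + 1) → (Fin N → Bool) × (Fin N → Bool)) :=
  piLaw fun i => prodLaw (ansLaw (E i) Plwe N) (ansLaw (E i) Punif N)

/-- At the genuine self-test laws this is `candEstLaw`. [folklore] -/
theorem candEstLawWith_eq : candEstLawWith E N (lweSamplesUniformSecret χ m) (uniformSamples ι R m) = candEstLaw χ E N := rfl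

/-- **Select using an arbitrary measurement law.** [cite: BrakerskiEtAl2013, Thm. 4.1 (proof)] -/
def selectWith (Est : PMF (Fin (k + 1) → (Fin N → Bool) × (Fin N → Bool))) : Distinguisher ι R m :=
  fun S => Est.bind fun a => selTest E N a S

/-- At `candEstLaw` this is `selectDistinguisher`. [folklore] -/
theorem selectWith_candEstLaw : selectWith E N (candEstLaw χ E N) = selectDistinguisher χ E N := rfl

variable {E N}

omit [Fintype ι] [DecidableEq ι] [CommRing R] [Fintype R] in
/-- Acceptance probability of the selection: average over the measurement. [folklore] -/
theorem pacc_selectWith (Est : PMF (Fin (k + 1) → (Fin N → Bool) × (Fin N → Bool))) (P : PMF (Fin m → (ι → R) × R)) :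
    pacc (selectWith E N Est) P = ∑ a, (Est a).toReal * pacc (selTest E N a) P := by
  have h : P.bind (selectWith E N Est) = Est.bind fun a => P.bind (selTest E N a) := by
    unfold selectWith
    rw [PMF.bind_comm]
  unfold pacc
  rw [h, PMF.bind_apply, tsum_fintype, ENNReal.toReal_sum (fun a _ =>
    ENNReal.mul_ne_top (PMF.apply_ne_top _ _) (PMF.apply_ne_top _ _))]
  exact Finset.sum_congr rfl fun a _ => ENNReal.toReal_mul

/-- Signed advantage of the selection: average over the measurement. [folklore] -/
theorem sAdv_selectWith (Est : PMF (Fin (k + 1) → (Fin N → Bool) × (Fin N → Bool))) :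
    sAdv χ m (selectWith E N Est) = ∑ a, (Est a).toReal * sAdv χ m (selTest E N a) := by
  unfold sAdv
  rw [pacc_selectWith, pacc_selectWith, ← Finset.sum_sub_distrib]
  exact Finset.sum_congr rfl fun a _ => by ring

/-- **The selection's signed advantage moves by at most `2Δ` with the measurement law.** [cite: Goldreich2001, §3.2.1] -/
theorem abs_sAdv_selectWith_sub_le (Est Est' : PMF (Fin (k + 1) → (Fin N → Bool) × (Fin N → Bool))) :
    |sAdv χ m (selectWith E N Est) - sAdv χ m (selectWith E N Est')| ≤ 2 * Est.tvDist Est' := by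
  rw [sAdv_selectWith, sAdv_selectWith]
  -- `h = (sAdv + 1)/2 ∈ [0, 1]`
  set h : (Fin (k + 1) → (Fin N → Bool) × (Fin N → Bool)) → ℝ := fun a => (sAdv χ m (selTest E N a) + 1) / 2 with hh
  have h0 : ∀ a, 0 ≤ h a := fun a => by
    have := (abs_le.1 (abs_sAdv_le_one χ m (selTest E N a))).1; simp only [hh]; linarith
  have h1 : ∀ a, h a ≤ 1 := fun a => by
    have := (abs_le.1 (abs_sAdv_le_one χ m (selTest E N a))).2; simp only [hh]; linarith
  have hrew : ∀ μ : PMF (Fin (k + 1) → (Fin N → Bool) × (Fin N → Bool)),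
      ∑ a, (μ a).toReal * sAdv χ m (selTest E N a) = 2 * ∑' a, (μ a).toReal * h a - 1 := by
    intro μ
    rw [tsum_fintype]
    have hs := sum_toReal_coe μ
    simp only [hh]
    rw [Finset.mul_sum]
    have : ∑ a, (μ a).toReal * sAdv χ m (selTest E N a) = ∑ a, (2 * ((μ a).toReal * ((sAdv χ m (selTest E N a) + 1) / 2)) - (μ a).toReal) := by
      refine Finset.sum_congr rfl fun a _ => by ring
    rw [this, Finset.sum_sub_distrib, hs]
  rw [hrew Est, hrew Est']
  have hle := tsum_toReal_mul_sub_le_tvDist Est Est' h0 h1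
  have hge := tsum_toReal_mul_sub_le_tvDist Est' Est h0 h1
  rw [PMF.tvDist_comm] at hge
  rw [abs_le]
  constructor <;> linarith

/-- **The SIGNED selection guarantee**: if some candidate has advantage `≥ η > 0`, then
`sAdv (selectDistinguisher) ≥ η/2 − 2(k+1)·32/(Nη²)`. [cite: BrakerskiEtAl2013, Thm. 4.1; RegevLWE2009, Lemma 4.1 (proof)] -/
theorem sAdv_selectDistinguisher_ge (hN : 0 < N) {η : ℝ} (hη : 0 < η) (hbest : ∃ i, η ≤ distinguishingAdvantage χ m (E i)) :
    η / 2 - 2 * ((k + 1 : ℕ) * (32 / (N * η ^ 2))) ≤ sAdv χ m (selectDistinguisher χ E N) := by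
  rw [sAdv_selectDistinguisher]
  have hacc := sum_toReal_mul_ge_of_good (candEstLaw χ E N) (fun a => sAdv χ m (selTest E N a))
    {a | ¬ CandGood χ E N η a} (c := η / 2)
    (fun a ha => sAdv_selTest_ge_of_candGood hN (by simpa using ha) hbest)
    (fun a => (abs_le.1 (abs_sAdv_le_one χ m (selTest E N a))).1)
  have hbad : ((candEstLaw χ E N).toOuterMeasure {a | ¬ CandGood χ E N η a}).toReal ≤ (k + 1 : ℕ) * (32 / (N * η ^ 2)) := by
    have h := prob_not_candGood_le (χ := χ) (E := E) hN hη
    have hfin : ((k + 1 : ℕ) : ℝ≥0∞) * ENNReal.ofReal (32 / (N * η ^ 2)) ≠ ⊤ :=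
      ENNReal.mul_ne_top (ENNReal.natCast_ne_top _) ENNReal.ofReal_ne_top
    calc ((candEstLaw χ E N).toOuterMeasure {a | ¬ CandGood χ E N η a}).toReal
        ≤ (((k + 1 : ℕ) : ℝ≥0∞) * ENNReal.ofReal (32 / (N * η ^ 2))).toReal := ENNReal.toReal_mono hfin h
      _ = (k + 1 : ℕ) * (32 / (N * η ^ 2)) := by
          rw [ENNReal.toReal_mul, ENNReal.toReal_natCast, ENNReal.toReal_ofReal (by positivity)]
  have hη1 : η ≤ 1 := by
    obtain ⟨i, hi⟩ := hbest
    rw [distinguishingAdvantage_eq_abs_sAdv] at hi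
    exact hi.trans (abs_sAdv_le_one χ m (E i))
  have h15 : (1 + η / 2) * ((candEstLaw χ E N).toOuterMeasure {a | ¬ CandGood χ E N η a}).toReal ≤
      2 * ((k + 1 : ℕ) * (32 / (N * η ^ 2))) := by
    have h0 : 0 ≤ ((candEstLaw χ E N).toOuterMeasure {a | ¬ CandGood χ E N η a}).toReal := ENNReal.toReal_nonneg
    nlinarith
  linarith

/-- **The selection with an approximate measurement is good**: if some candidate has advantage `≥ η > 0` and the measurement law is
`δ`-close to the genuine one, then `Adv[selectWith Est] ≥ η/2 − 2(k+1)·32/(Nη²) − 2δ`. [cite: BrakerskiEtAl2013, Thm. 4.1 with §5; Goldreich2001, §3.2.1] -/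
theorem distinguishingAdvantage_selectWith_ge (hN : 0 < N) {η : ℝ} (hη : 0 < η) (hbest : ∃ i, η ≤ distinguishingAdvantage χ m (E i))
    (Est : PMF (Fin (k + 1) → (Fin N → Bool) × (Fin N → Bool))) {δ : ℝ} (hδ : Est.tvDist (candEstLaw χ E N) ≤ δ) :
    η / 2 - 2 * ((k + 1 : ℕ) * (32 / (N * η ^ 2))) - 2 * δ ≤ distinguishingAdvantage χ m (selectWith E N Est) := by
  rw [distinguishingAdvantage_eq_abs_sAdv]
  refine le_trans ?_ (le_abs_self _)
  have h1 := sAdv_selectDistinguisher_ge (E := E) (N := N) χ hN hη hbest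
  have h2 := abs_sAdv_selectWith_sub_le (E := E) (N := N) χ Est (candEstLaw χ E N)
  rw [selectWith_candEstLaw] at h2
  have := (abs_le.1 h2).1
  linarith

/-! ### The measurement law is close when the self-test laws are -/

/-- `Δ(Ans_N(K, P), Ans_N(K, P')) ≤ N·Δ(P, P')`. [cite: Goldreich2001, §3.2.1, §3.2.3] -/
theorem tvDist_ansLaw_le {B : Type} (K : B → PMF Bool) (P P' : PMF B) (N : ℕ) :
    (ansLaw K P N).tvDist (ansLaw K P' N) ≤ N * P.tvDist P' := by
  rw [ansLaw_eq_iidPMF, ansLaw_eq_iidPMF]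
  refine (tvDist_iidPMF_le _ _ N).trans ?_
  exact mul_le_mul_of_nonneg_left (tvDist_bind_left_le P P' K) (Nat.cast_nonneg N)

variable (E N) in
omit [Fintype ι] [DecidableEq ι] [CommRing R] [Fintype R] in
/-- **Close self-test laws give a close measurement**: `Δ ≤ (k+1)·(N·Δ(P_lwe, P₀_lwe) + N·Δ(P_unif, P₀_unif))`.
[cite: Goldreich2001, §3.2.3; RegevLWE2009, Lemma 4.1 (proof)] -/
theorem tvDist_candEstLawWith_le (Plwe Punif Plwe' Punif' : PMF (Fin m → (ι → R) × R)) {ν₁ ν₂ : ℝ}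
    (h₁ : Plwe.tvDist Plwe' ≤ ν₁) (h₂ : Punif.tvDist Punif' ≤ ν₂) :
    (candEstLawWith E N Plwe Punif).tvDist (candEstLawWith E N Plwe' Punif') ≤ (k + 1 : ℕ) * (N * ν₁ + N * ν₂) := by
  unfold candEstLawWith
  refine tvDist_piLaw_le_of_forall_le _ _ fun i => ?_
  refine (BLPRS2013.tvDist_prodLaw_le _ _ _ _).trans ?_
  have hN0 : (0 : ℝ) ≤ N := Nat.cast_nonneg N
  exact add_le_add ((tvDist_ansLaw_le (E i) _ _ N).trans (mul_le_mul_of_nonneg_left h₁ hN0))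
    ((tvDist_ansLaw_le (E i) _ _ N).trans (mul_le_mul_of_nonneg_left h₂ hN0))

end LWE

end Literature.Computability.Cryptography

end
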